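import Summits.ABC.IUTFork.DAGL2t
import Summits.ABC.IUTFork.DAGL4r

/-!
# Kernel DAG index — witness UPGRADE part s (GENERATED by abc-iut-c312-2 gen 6 `work/gen_index.py upgrade` @2026-08-26T23:43Z from HOME/plan/DAG.tsv
(regenerated 2026-08-26T23:33:38Z); spec v1.3 §2(c) "`_holds` iff the DAG row is discharged", §5 "re-file when nodes change status")

THIS FILE PROVES NOTHING NEW AND ASSERTS NOTHING. For 5 nodes ALREADY INDEXED with a partial witness `N_<id>_part` (their DAG row was
`landed(p…)` when indexed) whose row is NOW `discharged(p…)`, it adds the discharge witness `N_<id>_holds : N_<id> := N_<id>_part` BY NAME —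
the node statement `N_<id>` is untouched (append-only across files: nothing landed is redefined). Nothing here says abc is proved or refuted
or takes a side on [IUTchIII] Cor 3.12. typed ≠ discharged; indexed ≠ endorsed.
-/

namespace Summit.ABC.IUTFork.DAG

/-- [node EtTh:Lem5.9(v) · L2/D1 · DAG status discharged(p471697)] discharge witness of `N_EtTh_Lem5_9_v` (indexed in `DAGL2t` with `_part` while the row was landed; now discharged, p471697): BY NAME; proves nothing new. -/
theorem N_EtTh_Lem5_9_v_holds : N_EtTh_Lem5_9_v := N_EtTh_Lem5_9_v_part

/-- [node AbsTopIII:Cor3.7(i) · L4/D1 · DAG status discharged(p409940)] discharge witness of `N_AbsTopIII_Cor3_7_i` (indexed in `DAGL4r` with `_part` while the row was landed; now discharged, p409940): BY NAME; proves nothing new. -/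
theorem N_AbsTopIII_Cor3_7_i_holds : N_AbsTopIII_Cor3_7_i := N_AbsTopIII_Cor3_7_i_part

/-- [node AbsTopIII:Cor3.7(ii) · L4/D1 · DAG status discharged(p411508)] discharge witness of `N_AbsTopIII_Cor3_7_ii` (indexed in `DAGL4r` with `_part` while the row was landed; now discharged, p411508): BY NAME; proves nothing new. -/
theorem N_AbsTopIII_Cor3_7_ii_holds : N_AbsTopIII_Cor3_7_ii := N_AbsTopIII_Cor3_7_ii_part

/-- [node AbsTopIII:Cor3.7(iv) · L4/D1 · DAG status discharged(p411191)] discharge witness of `N_AbsTopIII_Cor3_7_iv` (indexed in `DAGL4r` with `_part` while the row was landed; now discharged, p411191): BY NAME; proves nothing new. -/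
theorem N_AbsTopIII_Cor3_7_iv_holds : N_AbsTopIII_Cor3_7_iv := N_AbsTopIII_Cor3_7_iv_part

/-- [node AbsTopIII:Cor3.7(v) · L4/D1 · DAG status discharged(p428428)] discharge witness of `N_AbsTopIII_Cor3_7_v` (indexed in `DAGL4r` with `_part` while the row was landed; now discharged, p428428): BY NAME; proves nothing new. -/
theorem N_AbsTopIII_Cor3_7_v_holds : N_AbsTopIII_Cor3_7_v := N_AbsTopIII_Cor3_7_v_part

end Summit.ABC.IUTFork.DAG
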